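import Summits.QuantumFields.YangMills.Theorems.FluctuationComparisonRegPrIntLS2BetaFibreTransport
import Summits.QuantumFields.YangMills.Theorems.FluctuationComparisonRegPrIntLS2BetaSignedCombLipschitz
import Literature.MathematicalPhysics.QuantumFieldTheory.Balaban1983to89.Node00.AveragingSmooth
import HarnessLib

/-!
# S2β · POS∘ — THE TAYLOR HALF (T2a): «GROWTH ROW ALONG A FIBRED TRANSVERSAL ⟹ THE POS∘ COLLAR», the orbit-distance letters and the abstract collar

Cell `ym3-torus` (YM ladder rung R3 = continuum `SU(2)` Yang–Mills on the three-torus at fixed lattice data — a RUNG: NOT d = 4, NOT infinite volume,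
NOT a mass gap, NOT Clay).  Width seat `ym3-torus-px21` (gen 18); pen named by px8 g18 (STATUS 22:20:29Z) after ✓`…S2BetaTubeGrowthOfIsolated` (TUBE♭ ⟸ {POS∘, ISOL∘(δ)});
(T1) = ✓∕⧗`…S2BetaGrowthOfHessianPos` (HESS∘ ⟹ the growth row).  Crux `stmt-QuantumFields-20520` (`…Theses.UnitScaleTilt.FluctuationComparisonRegPrIntL`), LINE g18-1 S2β;
`--kind proof --supports stmt-QuantumFields-20520 --as helper`, count-neutral, DEFINITION-FREE (0 `def`, 0 `instance`, 0 `notation`, 0 `sorry`, default heartbeats).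

WHY.  px8's POS∘ letter (the `hpos` binder of ✓`tubeGrowth_of_pos_of_isolated`) is COLLAR GROWTH of the action in the residual-orbit distance
`D U := ⨅_{w residual} Σ_ℓ dist1 (U ℓ·((w•U₀) ℓ)⁻¹)²`: «`∃ r c > 0`, on `closure (fibre ∩ histGood) ∩ tube`, `D U ≤ r ⇒ c·D U ≤ A U − min`».  The tree's (and
print's (142)) currency is growth along a TRANSVERSAL `Ψ : Y → fields` through `U₀` in chart coordinates, `∃ c₁ > 0, ∀ᶠ y in 𝓝 0, c₁‖y‖² ≤ A (Ψ y) − m`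
((T1) from HESS∘; ✓`…ChartPackageGrowthRow` from GAP♯).  THIS FILE is the dictionary between the two, with every geometric input a displayed row:
* §1 `iInf_orbitDistSq_gaugeAct_left` — `D (w•U) = D U` for residual `w` (conjugation invariance of `dist1` + re-indexing the residual set), `iInf_orbitDistSq_le_sum_one`
  (`D U ≤ Σ_ℓ dist1 (U ℓ·(U₀ ℓ)⁻¹)²`, the `w = 1` term), `continuous_gaugeAct_right`;
* §2 ★★ `exists_orbitDist_le_imp_gaugeAct_mem` — SMALL ORBIT DISTANCE ⟹ INSIDE ANY NEIGHBOURHOOD OF `U₀` UP TO A RESIDUAL TRANSFORMATION: for `N ∈ 𝓝 U₀`,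
  `∃ r > 0, ∀ U, D U ≤ r → ∃ w residual, w•U ∈ N` (compactness of `SU(2)^{bonds}`, continuity of `D` ✓`continuous_iInf_orbitDistSq`, and `D = 0 ⇒ orbit`
  ✓`exists_eq_gaugeAct_of_iInf_le_zero` — the same glue pattern as px8's §1, no metric estimate needed);
* §3 ★ `exists_orbitDist_le_mul_norm_sq` — THE DICTIONARY ROW from differentiability: `Ψ 0 = U₀` and `y ↦ ↑(Ψ y)` (matrix field) differentiable at `0` ⟹
  `∃ C > 0, ∀ᶠ y in 𝓝 0, D (Ψ y) ≤ C‖y‖²` (`dist1 (a·b⁻¹) = ‖a − b‖`, ✓`dist1_mul_inv_eq_norm_sub`; `HasFDerivAt.isBigO_sub`);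
* §4 ★★★ `posCollar_of_growthRow_of_cover` — THE ABSTRACT COLLAR: growth row along `Ψ` + dictionary row + COVER row («every point of `closure (fibre ∩ histGood)` at
  small orbit distance is `w • Ψ y` with `y` in any prescribed neighbourhood of `0`, `w` residual») ⟹ px8's `hpos` text VERBATIM (`c := c₁ ∕ C`); and
  ★★★ `posCollar_of_growthRow` — the same with the dictionary row discharged by §3.
The COVER row for the tube chart of record docked on a fibred chart (`ChartData.Φ (V, σ ·)`: chart surjectivity `𝓝 U₀ ≤ map Θ (𝓝 0)` + RECOGNITION) is (T2b), next file.

HONEST: topology∕bookkeeping over landed letters; the growth row (⟸ HESS∘, print's (142) — [Balaban1985Variational] p.299, [Balaban1985BackgroundPropagators] Thm 3.11) is a DISPLAYED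
hypothesis; POS∘ is derived FROM it, not proved outright; ISOL∘(δ), TUBE-REG∘, GAP♯∘, GAP♭, EXW∘, S2β, crux 20520 NOT proved; no summit statement is proved by a helper;
finite-volume ∕ conditional; rung R3 = SU(2) YM₃ on T³ — NOT d = 4, NOT infinite volume, NOT a mass gap, NOT Clay; the Yang–Mills mass gap is NOT proved.  Sorry-free, axioms standard.

References: T. Bałaban, CMP **102** (1985) 277–309 [Balaban1985Variational] (Thm 1 (8)–(10) p.279, (142) p.299); CMP **102** (1985) 255–275 [Balaban1985UV3] ((12)–(13) p.259,
(18)–(22) p.260); CMP **98** (1985) 17–51 [Balaban1985Averaging] ((8) p.19, (19) p.21).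
-/

set_option autoImplicit false

noncomputable section

namespace Summit.QuantumFields.YangMills.Theorems.FluctuationComparisonRegPrIntLS2BetaPosCollarOfGrowthRow

open Set Filter Topology Asymptotics
open scoped Matrix.Norms.L2Operator
open Literature.MathematicalPhysics.QuantumFieldTheory.Balaban1983to89
open Literature.MathematicalPhysics.QuantumFieldTheory.Balaban1983to89.T3ContinuumYM3Torus
open Literature.MathematicalPhysics.QuantumFieldTheory.Balaban1983to89.T3UnitLawDensityEML (ℰp)
open Literature.MathematicalPhysics.QuantumFieldTheory.Balaban1983to89.T3UnitScaleTilt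
open Literature.MathematicalPhysics.QuantumFieldTheory.Balaban1983to89.T3TiltDescent
open Literature.MathematicalPhysics.QuantumFieldTheory.Balaban1983to89.T3ConstrainedMinimiser (fibre)
open Literature.MathematicalPhysics.QuantumFieldTheory.Balaban1983to89.T3PrintedRegularMinimiser
open Literature.MathematicalPhysics.QuantumFieldTheory.Balaban1983to89.T4Continuum
open scoped Literature.MathematicalPhysics.QuantumFieldTheory.Balaban1983to89.T3OrbitAverage
open Summit.QuantumFields.YangMills.Theorems.FluctuationComparisonRegPrIntLS2BetaResidualGauge
open Summit.QuantumFields.YangMills.Theorems.FluctuationComparisonRegPrIntLS2BetaResidualGaugeOrbit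
open Summit.QuantumFields.YangMills.Theorems.FluctuationComparisonRegPrIntLS2BetaFibreTransport (continuous_iInf_orbitDistSq)
open Summit.QuantumFields.YangMills.Theorems.FluctuationComparisonRegPrIntLS2BetaSignedCombLipschitz (dist1_mul_inv_eq_norm_sub)
open Literature.MathematicalPhysics.QuantumFieldTheory.Balaban1983to89.Node00 (coeField coeField_apply)

variable (F : T3Family) {J K : ℕ} (hJK : J ≤ K)

/-! ## §1 Orbit-distance letters -/

section Letters

/-- For a fixed gauge transformation `w`, `U ↦ w • U` is continuous (bondwise `w(b₋)·U(b)·w(b₊)⁻¹`). [cite: Balaban1985Averaging, (8) p.19] -/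
theorem continuous_gaugeAct_right (w : Site (F.P K) 0 → Matrix.specialUnitaryGroup (Fin 2) ℂ) :
    Continuous fun U : GaugeField (F.P K) 0 (Matrix.specialUnitaryGroup (Fin 2) ℂ) => GaugeField.gaugeAct w U := by
  refine continuous_pi fun b => ?_
  show Continuous fun U : GaugeField (F.P K) 0 (Matrix.specialUnitaryGroup (Fin 2) ℂ) => w b.src * U b * (w b.tgt)⁻¹
  exact (continuous_const.mul (continuous_apply b)).mul continuous_const

/-- Bondwise: `(w•U) ℓ · ((w'•U₀) ℓ)⁻¹` is the `w(ℓ₋)`-conjugate of `U ℓ · (((w⁻¹w')•U₀) ℓ)⁻¹`, so their `dist1` agree. [cite: Balaban1985Averaging, (8) p.19] -/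
theorem dist1_gaugeAct_mul_inv_gaugeAct (w w' : Site (F.P K) 0 → Matrix.specialUnitaryGroup (Fin 2) ℂ)
    (U U₀ : GaugeField (F.P K) 0 (Matrix.specialUnitaryGroup (Fin 2) ℂ)) (ℓ : PBond (F.P K) 0) :
    dist1 ((GaugeField.gaugeAct w U) ℓ * ((GaugeField.gaugeAct w' U₀) ℓ)⁻¹) =
      dist1 (U ℓ * ((GaugeField.gaugeAct (w⁻¹ * w') U₀) ℓ)⁻¹) := by
  have h : (GaugeField.gaugeAct w U) ℓ * ((GaugeField.gaugeAct w' U₀) ℓ)⁻¹ =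
      w ℓ.src * (U ℓ * ((GaugeField.gaugeAct (w⁻¹ * w') U₀) ℓ)⁻¹) * (w ℓ.src)⁻¹ := by
    simp only [GaugeField.gaugeAct, Pi.mul_apply, Pi.inv_apply, mul_inv_rev, inv_inv, mul_assoc, mul_inv_cancel, mul_one]
  rw [h, GaugeGroup.dist1_conj]

/-- ★ **THE ORBIT DISTANCE DOES NOT SEE RESIDUAL TRANSFORMATIONS OF THE FIELD**: for a residual `w`,
`⨅_{w'} Σ_ℓ dist1 ((w•U) ℓ·((w'•U₀) ℓ)⁻¹)² = ⨅_{w'} Σ_ℓ dist1 (U ℓ·((w'•U₀) ℓ)⁻¹)²` (bondwise conjugation + the bijection `w' ↦ w⁻¹w'` of the residual set).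
[cite: Balaban1987RG1, p.256 (three sentences after (0.21)); Balaban1985Averaging, (8) p.19] -/
theorem iInf_orbitDistSq_gaugeAct_left {w : Site (F.P K) 0 → Matrix.specialUnitaryGroup (Fin 2) ℂ}
    (hw : ∀ U : GaugeField (F.P K) 0 (Matrix.specialUnitaryGroup (Fin 2) ℂ),
      descendTo F ℰp J K hJK (GaugeField.gaugeAct w U) = descendTo F ℰp J K hJK U)
    (U U₀ : GaugeField (F.P K) 0 (Matrix.specialUnitaryGroup (Fin 2) ℂ)) :
    (⨅ w' : {w : Site (F.P K) 0 → Matrix.specialUnitaryGroup (Fin 2) ℂ |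
          ∀ U : GaugeField (F.P K) 0 (Matrix.specialUnitaryGroup (Fin 2) ℂ),
            descendTo F ℰp J K hJK (GaugeField.gaugeAct w U) = descendTo F ℰp J K hJK U},
        ∑ ℓ : PBond (F.P K) 0,
          dist1 ((GaugeField.gaugeAct w U) ℓ * ((GaugeField.gaugeAct (w' : Site (F.P K) 0 → Matrix.specialUnitaryGroup (Fin 2) ℂ) U₀) ℓ)⁻¹) ^ 2) =
      ⨅ w' : {w : Site (F.P K) 0 → Matrix.specialUnitaryGroup (Fin 2) ℂ |
          ∀ U : GaugeField (F.P K) 0 (Matrix.specialUnitaryGroup (Fin 2) ℂ),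
            descendTo F ℰp J K hJK (GaugeField.gaugeAct w U) = descendTo F ℰp J K hJK U},
        ∑ ℓ : PBond (F.P K) 0,
          dist1 (U ℓ * ((GaugeField.gaugeAct (w' : Site (F.P K) 0 → Matrix.specialUnitaryGroup (Fin 2) ℂ) U₀) ℓ)⁻¹) ^ 2 := by
  -- left translation by `w⁻¹` on the residual set
  let e : {w : Site (F.P K) 0 → Matrix.specialUnitaryGroup (Fin 2) ℂ |
        ∀ U : GaugeField (F.P K) 0 (Matrix.specialUnitaryGroup (Fin 2) ℂ),
          descendTo F ℰp J K hJK (GaugeField.gaugeAct w U) = descendTo F ℰp J K hJK U} →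
      {w : Site (F.P K) 0 → Matrix.specialUnitaryGroup (Fin 2) ℂ |
        ∀ U : GaugeField (F.P K) 0 (Matrix.specialUnitaryGroup (Fin 2) ℂ),
          descendTo F ℰp J K hJK (GaugeField.gaugeAct w U) = descendTo F ℰp J K hJK U} :=
    fun w' => ⟨w⁻¹ * (w' : Site (F.P K) 0 → Matrix.specialUnitaryGroup (Fin 2) ℂ), residual_mul F hJK (residual_inv F hJK hw) w'.2⟩
  have he : Function.Surjective e := by
    intro w''
    refine ⟨⟨w * (w'' : Site (F.P K) 0 → Matrix.specialUnitaryGroup (Fin 2) ℂ), residual_mul F hJK hw w''.2⟩, Subtype.ext ?_⟩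
    show w⁻¹ * (w * (w'' : Site (F.P K) 0 → Matrix.specialUnitaryGroup (Fin 2) ℂ)) = w''
    rw [inv_mul_cancel_left]
  have h1 : (⨅ w' : {w : Site (F.P K) 0 → Matrix.specialUnitaryGroup (Fin 2) ℂ |
          ∀ U : GaugeField (F.P K) 0 (Matrix.specialUnitaryGroup (Fin 2) ℂ),
            descendTo F ℰp J K hJK (GaugeField.gaugeAct w U) = descendTo F ℰp J K hJK U},
        ∑ ℓ : PBond (F.P K) 0,
          dist1 ((GaugeField.gaugeAct w U) ℓ * ((GaugeField.gaugeAct (w' : Site (F.P K) 0 → Matrix.specialUnitaryGroup (Fin 2) ℂ) U₀) ℓ)⁻¹) ^ 2) =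
      ⨅ w' : {w : Site (F.P K) 0 → Matrix.specialUnitaryGroup (Fin 2) ℂ |
          ∀ U : GaugeField (F.P K) 0 (Matrix.specialUnitaryGroup (Fin 2) ℂ),
            descendTo F ℰp J K hJK (GaugeField.gaugeAct w U) = descendTo F ℰp J K hJK U},
        ∑ ℓ : PBond (F.P K) 0,
          dist1 (U ℓ * ((GaugeField.gaugeAct ((e w' : {w : Site (F.P K) 0 → Matrix.specialUnitaryGroup (Fin 2) ℂ |
              ∀ U : GaugeField (F.P K) 0 (Matrix.specialUnitaryGroup (Fin 2) ℂ),
                descendTo F ℰp J K hJK (GaugeField.gaugeAct w U) = descendTo F ℰp J K hJK U}) :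
            Site (F.P K) 0 → Matrix.specialUnitaryGroup (Fin 2) ℂ) U₀) ℓ)⁻¹) ^ 2 := by
    refine iInf_congr fun w' => Finset.sum_congr rfl fun ℓ _ => ?_
    rw [dist1_gaugeAct_mul_inv_gaugeAct]
  rw [h1]
  exact he.iInf_comp (fun w'' : {w : Site (F.P K) 0 → Matrix.specialUnitaryGroup (Fin 2) ℂ |
      ∀ U : GaugeField (F.P K) 0 (Matrix.specialUnitaryGroup (Fin 2) ℂ),
        descendTo F ℰp J K hJK (GaugeField.gaugeAct w U) = descendTo F ℰp J K hJK U} =>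
    ∑ ℓ : PBond (F.P K) 0,
      dist1 (U ℓ * ((GaugeField.gaugeAct (w'' : Site (F.P K) 0 → Matrix.specialUnitaryGroup (Fin 2) ℂ) U₀) ℓ)⁻¹) ^ 2)

/-- The orbit distance is at most its `w = 1` term `Σ_ℓ dist1 (U ℓ·(U₀ ℓ)⁻¹)²`. [cite: Balaban1985Variational, Thm 1 (8)-(10) p.279] -/
theorem iInf_orbitDistSq_le_sum_one (U U₀ : GaugeField (F.P K) 0 (Matrix.specialUnitaryGroup (Fin 2) ℂ)) :
    (⨅ w' : {w : Site (F.P K) 0 → Matrix.specialUnitaryGroup (Fin 2) ℂ |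
          ∀ U : GaugeField (F.P K) 0 (Matrix.specialUnitaryGroup (Fin 2) ℂ),
            descendTo F ℰp J K hJK (GaugeField.gaugeAct w U) = descendTo F ℰp J K hJK U},
        ∑ ℓ : PBond (F.P K) 0,
          dist1 (U ℓ * ((GaugeField.gaugeAct (w' : Site (F.P K) 0 → Matrix.specialUnitaryGroup (Fin 2) ℂ) U₀) ℓ)⁻¹) ^ 2) ≤
      ∑ ℓ : PBond (F.P K) 0, dist1 (U ℓ * (U₀ ℓ)⁻¹) ^ 2 := by
  have hbdd : BddBelow (Set.range fun w' : {w : Site (F.P K) 0 → Matrix.specialUnitaryGroup (Fin 2) ℂ |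
      ∀ U : GaugeField (F.P K) 0 (Matrix.specialUnitaryGroup (Fin 2) ℂ),
        descendTo F ℰp J K hJK (GaugeField.gaugeAct w U) = descendTo F ℰp J K hJK U} =>
      ∑ ℓ : PBond (F.P K) 0,
        dist1 (U ℓ * ((GaugeField.gaugeAct (w' : Site (F.P K) 0 → Matrix.specialUnitaryGroup (Fin 2) ℂ) U₀) ℓ)⁻¹) ^ 2) :=
    ⟨0, by rintro _ ⟨w', rfl⟩; exact Finset.sum_nonneg fun ℓ _ => sq_nonneg _⟩
  have h1 := ciInf_le hbdd ⟨1, residual_one F hJK⟩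
  refine h1.trans (le_of_eq (Finset.sum_congr rfl fun ℓ _ => ?_))
  have : (GaugeField.gaugeAct (1 : Site (F.P K) 0 → Matrix.specialUnitaryGroup (Fin 2) ℂ) U₀) = U₀ := B12RTGaugeInvariance254.gaugeAct_one' U₀
  rw [this]

end Letters

/-! ## §2 Small orbit distance ⟹ inside any neighbourhood of the base point, up to a residual transformation -/

section Near

/-- ★★ **SMALL ORBIT DISTANCE ⟹ NEAR `U₀` UP TO A RESIDUAL TRANSFORMATION.**  For every neighbourhood `N` of `U₀` there is `r > 0` such that every field `U` with
orbit distance `⨅_w Σ_ℓ dist1 (U ℓ·((w•U₀) ℓ)⁻¹)² ≤ r` satisfies `w•U ∈ N` for some residual `w`.  Proof: the set `M` of fields with `w•U ∈ interior N` for some residual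
`w` is open and contains the orbit `{D = 0}` (✓`exists_eq_gaugeAct_of_iInf_le_zero`); on the compact complement the continuous `D` (✓`continuous_iInf_orbitDistSq`) has a
positive minimum. [cite: Balaban1985UV3, (12)-(13) p.259; Balaban1985Variational, Thm 1 (8)-(10) p.279] -/
theorem exists_orbitDist_le_imp_gaugeAct_mem (U₀ : GaugeField (F.P K) 0 (Matrix.specialUnitaryGroup (Fin 2) ℂ))
    {N : Set (GaugeField (F.P K) 0 (Matrix.specialUnitaryGroup (Fin 2) ℂ))} (hN : N ∈ 𝓝 U₀) :
    ∃ r : ℝ, 0 < r ∧ ∀ U : GaugeField (F.P K) 0 (Matrix.specialUnitaryGroup (Fin 2) ℂ),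
      (⨅ w' : {w : Site (F.P K) 0 → Matrix.specialUnitaryGroup (Fin 2) ℂ |
            ∀ U : GaugeField (F.P K) 0 (Matrix.specialUnitaryGroup (Fin 2) ℂ),
              descendTo F ℰp J K hJK (GaugeField.gaugeAct w U) = descendTo F ℰp J K hJK U},
          ∑ ℓ : PBond (F.P K) 0,
            dist1 (U ℓ * ((GaugeField.gaugeAct (w' : Site (F.P K) 0 → Matrix.specialUnitaryGroup (Fin 2) ℂ) U₀) ℓ)⁻¹) ^ 2) ≤ r →
      ∃ w : Site (F.P K) 0 → Matrix.specialUnitaryGroup (Fin 2) ℂ,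
        (∀ U'' : GaugeField (F.P K) 0 (Matrix.specialUnitaryGroup (Fin 2) ℂ),
            descendTo F ℰp J K hJK (GaugeField.gaugeAct w U'') = descendTo F ℰp J K hJK U'') ∧
          GaugeField.gaugeAct w U ∈ N := by
  classical
  set D : GaugeField (F.P K) 0 (Matrix.specialUnitaryGroup (Fin 2) ℂ) → ℝ := fun U =>
    ⨅ w' : {w : Site (F.P K) 0 → Matrix.specialUnitaryGroup (Fin 2) ℂ |
        ∀ U : GaugeField (F.P K) 0 (Matrix.specialUnitaryGroup (Fin 2) ℂ),
          descendTo F ℰp J K hJK (GaugeField.gaugeAct w U) = descendTo F ℰp J K hJK U},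
      ∑ ℓ : PBond (F.P K) 0,
        dist1 (U ℓ * ((GaugeField.gaugeAct (w' : Site (F.P K) 0 → Matrix.specialUnitaryGroup (Fin 2) ℂ) U₀) ℓ)⁻¹) ^ 2 with hD_def
  set M : Set (GaugeField (F.P K) 0 (Matrix.specialUnitaryGroup (Fin 2) ℂ)) :=
    {U | ∃ w : Site (F.P K) 0 → Matrix.specialUnitaryGroup (Fin 2) ℂ,
      (∀ U'' : GaugeField (F.P K) 0 (Matrix.specialUnitaryGroup (Fin 2) ℂ),
          descendTo F ℰp J K hJK (GaugeField.gaugeAct w U'') = descendTo F ℰp J K hJK U'') ∧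
        GaugeField.gaugeAct w U ∈ interior N} with hM_def
  have hMo : IsOpen M := by
    have hMeq : M = ⋃ w : {w : Site (F.P K) 0 → Matrix.specialUnitaryGroup (Fin 2) ℂ |
        ∀ U : GaugeField (F.P K) 0 (Matrix.specialUnitaryGroup (Fin 2) ℂ),
          descendTo F ℰp J K hJK (GaugeField.gaugeAct w U) = descendTo F ℰp J K hJK U},
        (fun U => GaugeField.gaugeAct (w : Site (F.P K) 0 → Matrix.specialUnitaryGroup (Fin 2) ℂ) U) ⁻¹' interior N := by
      ext U
      simp only [hM_def, mem_setOf_eq, mem_iUnion, mem_preimage]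
      constructor
      · rintro ⟨w, hw, hU⟩
        exact ⟨⟨w, hw⟩, hU⟩
      · rintro ⟨w, hU⟩
        exact ⟨w, w.2, hU⟩
    rw [hMeq]
    exact isOpen_iUnion fun w => isOpen_interior.preimage (continuous_gaugeAct_right F _)
  have hDc : Continuous D := continuous_iInf_orbitDistSq F hJK U₀
  -- on the orbit, `D = 0` and the point is in `M`
  have horb : ∀ U, D U ≤ 0 → U ∈ M := by
    intro U hU
    obtain ⟨w, hw, hUw⟩ := exists_eq_gaugeAct_of_iInf_le_zero F hJK U U₀ hU
    refine ⟨w⁻¹, residual_inv F hJK hw, ?_⟩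
    rw [hUw, gaugeAct_inv_gaugeAct]
    exact mem_interior_iff_mem_nhds.2 hN
  have hMc : IsCompact Mᶜ := hMo.isClosed_compl.isCompact
  rcases (Mᶜ).eq_empty_or_nonempty with hemp | hne
  · refine ⟨1, one_pos, fun U _ => ?_⟩
    have hUM : U ∈ M := by
      by_contra h
      have : U ∈ Mᶜ := h
      rw [hemp] at this
      exact this
    obtain ⟨w, hw, hU⟩ := hUM
    exact ⟨w, hw, interior_subset hU⟩
  · obtain ⟨U₁, hU₁, hmin⟩ := hMc.exists_isMinOn hne hDc.continuousOn
    have hε : 0 < D U₁ := by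
      by_contra h
      exact hU₁ (horb U₁ (not_lt.1 h))
    refine ⟨D U₁ / 2, by positivity, fun U hU => ?_⟩
    have hUM : U ∈ M := by
      by_contra h
      have h' : D U₁ ≤ D U := hmin (show U ∈ Mᶜ from h)
      have : D U ≤ D U₁ / 2 := hU
      linarith
    obtain ⟨w, hw, hU'⟩ := hUM
    exact ⟨w, hw, interior_subset hU'⟩

end Near

/-! ## §3 The dictionary row from differentiability of the transversal's matrix field -/

section Dictionary

variable {Y : Type*} [NormedAddCommGroup Y] [NormedSpace ℝ Y]

/-- ★ **THE DICTIONARY ROW**: if `Ψ 0 = U₀` and the matrix field `y ↦ ↑(Ψ y)` is differentiable at `0`, then `∃ C > 0, ∀ᶠ y in 𝓝 0,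
⨅_w Σ_ℓ dist1 ((Ψ y) ℓ·((w•U₀) ℓ)⁻¹)² ≤ C‖y‖²` — the orbit distance is at most its `w = 1` term, `dist1 (a·b⁻¹) = ‖a − b‖` bondwise (✓`dist1_mul_inv_eq_norm_sub`), and a
differentiable map is big-O of `‖y‖` at the point. [cite: Balaban1985Averaging, (19) p.21; Balaban1985Variational, (142) p.299] -/
theorem exists_orbitDist_le_mul_norm_sq (U₀ : GaugeField (F.P K) 0 (Matrix.specialUnitaryGroup (Fin 2) ℂ))
    (Ψ : Y → GaugeField (F.P K) 0 (Matrix.specialUnitaryGroup (Fin 2) ℂ)) (hΨ0 : Ψ 0 = U₀)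
    (hΨd : DifferentiableAt ℝ (fun y => coeField (Ψ y)) 0) :
    ∃ C : ℝ, 0 < C ∧ ∀ᶠ y in 𝓝 (0 : Y),
      (⨅ w' : {w : Site (F.P K) 0 → Matrix.specialUnitaryGroup (Fin 2) ℂ |
            ∀ U : GaugeField (F.P K) 0 (Matrix.specialUnitaryGroup (Fin 2) ℂ),
              descendTo F ℰp J K hJK (GaugeField.gaugeAct w U) = descendTo F ℰp J K hJK U},
          ∑ ℓ : PBond (F.P K) 0,
            dist1 ((Ψ y) ℓ * ((GaugeField.gaugeAct (w' : Site (F.P K) 0 → Matrix.specialUnitaryGroup (Fin 2) ℂ) U₀) ℓ)⁻¹) ^ 2) ≤ C * ‖y‖ ^ 2 := by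
  have hO : (fun y => coeField (Ψ y) - coeField (Ψ 0)) =O[𝓝 (0 : Y)] fun y => y - 0 := hΨd.hasFDerivAt.isBigO_sub
  obtain ⟨C₀, hC₀, hbound⟩ := hO.exists_pos
  have hb := hbound.bound
  -- the number of bonds, as an opaque real constant
  obtain ⟨n, hn0, hn⟩ : ∃ n : ℝ, 0 ≤ n ∧ ∀ x : ℝ, (∑ _ℓ : PBond (F.P K) 0, x) = n * x :=
    ⟨((Finset.univ : Finset (PBond (F.P K) 0)).card : ℝ), Nat.cast_nonneg _, fun x => by rw [Finset.sum_const, nsmul_eq_mul]⟩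
  refine ⟨n * C₀ ^ 2 + 1, by nlinarith [sq_nonneg C₀, mul_nonneg hn0 (sq_nonneg C₀)], ?_⟩
  filter_upwards [hb] with y hy
  rw [sub_zero, hΨ0] at hy
  have hterm : ∀ ℓ : PBond (F.P K) 0, dist1 ((Ψ y) ℓ * (U₀ ℓ)⁻¹) ≤ C₀ * ‖y‖ := fun ℓ => by
    rw [dist1_mul_inv_eq_norm_sub]
    have h := norm_le_pi_norm (coeField (Ψ y) - coeField U₀) ℓ
    rw [Pi.sub_apply, coeField_apply, coeField_apply] at h
    exact h.trans hy
  calc (⨅ w' : {w : Site (F.P K) 0 → Matrix.specialUnitaryGroup (Fin 2) ℂ |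
            ∀ U : GaugeField (F.P K) 0 (Matrix.specialUnitaryGroup (Fin 2) ℂ),
              descendTo F ℰp J K hJK (GaugeField.gaugeAct w U) = descendTo F ℰp J K hJK U},
          ∑ ℓ : PBond (F.P K) 0,
            dist1 ((Ψ y) ℓ * ((GaugeField.gaugeAct (w' : Site (F.P K) 0 → Matrix.specialUnitaryGroup (Fin 2) ℂ) U₀) ℓ)⁻¹) ^ 2)
        ≤ ∑ ℓ : PBond (F.P K) 0, dist1 ((Ψ y) ℓ * (U₀ ℓ)⁻¹) ^ 2 := iInf_orbitDistSq_le_sum_one F hJK (Ψ y) U₀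
    _ ≤ ∑ _ℓ : PBond (F.P K) 0, (C₀ * ‖y‖) ^ 2 :=
        Finset.sum_le_sum fun ℓ _ => pow_le_pow_left₀ (GaugeGroup.dist1_nonneg _) (hterm ℓ) 2
    _ = n * (C₀ * ‖y‖) ^ 2 := hn _
    _ ≤ (n * C₀ ^ 2 + 1) * ‖y‖ ^ 2 := by nlinarith [sq_nonneg ‖y‖]

end Dictionary

/-! ## §4 The abstract collar: growth row + dictionary row + cover row ⟹ px8's POS∘ letter -/

section Collar

variable {Y : Type*} [NormedAddCommGroup Y] [NormedSpace ℝ Y] {γ b₀ p₀ ε₀ : ℝ}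

omit [NormedSpace ℝ Y] in
/-- ★★★ **POS∘ COLLAR ⟸ GROWTH ROW + DICTIONARY ROW + COVER ROW** (abstract transversal `Ψ : Y → fields`).  Rows: `hgrow` — the tree's growth row along `Ψ`
(`∃ c₁ > 0, ∀ᶠ y in 𝓝 0, c₁‖y‖² ≤ A (Ψ y) − minActionRegPr … V`; (T1) ✓`growthRow_of_hessian_pos` from HESS∘); `hdict` — `∃ C > 0, ∀ᶠ y, D (Ψ y) ≤ C‖y‖²` (§3);
`hcover` — for every neighbourhood `s` of `0`, every point of `closure (fibre ∩ histGood)` at orbit distance `≤ r(s)` is `w • Ψ y` with `y ∈ s`, `w` residual ((T2b) for the tube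
chart of record docked on a fibred chart).  Conclusion: the `hpos` binder of ✓`…S2BetaTubeGrowthOfIsolated.tubeGrowth_of_pos_of_isolated` VERBATIM, with `c := c₁ ∕ C`.
[cite: Balaban1985Variational, (142) p.299; Balaban1985UV3, (18)-(22) p.260] -/
theorem posCollar_of_growthRow_of_cover
    (V : GaugeField (F.P J) 0 (Matrix.specialUnitaryGroup (Fin 2) ℂ)) (U₀ : GaugeField (F.P K) 0 (Matrix.specialUnitaryGroup (Fin 2) ℂ)) (δ : ℝ)
    (Ψ : Y → GaugeField (F.P K) 0 (Matrix.specialUnitaryGroup (Fin 2) ℂ))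
    (hgrow : ∃ c₁ : ℝ, 0 < c₁ ∧ ∀ᶠ y in 𝓝 (0 : Y), c₁ * ‖y‖ ^ 2 ≤ wilsonAction4 (Ψ y) - minActionRegPr F J K hJK ε₀ V)
    (hdict : ∃ C : ℝ, 0 < C ∧ ∀ᶠ y in 𝓝 (0 : Y),
      (⨅ w' : {w : Site (F.P K) 0 → Matrix.specialUnitaryGroup (Fin 2) ℂ |
            ∀ U : GaugeField (F.P K) 0 (Matrix.specialUnitaryGroup (Fin 2) ℂ),
              descendTo F ℰp J K hJK (GaugeField.gaugeAct w U) = descendTo F ℰp J K hJK U},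
          ∑ ℓ : PBond (F.P K) 0,
            dist1 ((Ψ y) ℓ * ((GaugeField.gaugeAct (w' : Site (F.P K) 0 → Matrix.specialUnitaryGroup (Fin 2) ℂ) U₀) ℓ)⁻¹) ^ 2) ≤ C * ‖y‖ ^ 2)
    (hcover : ∀ s ∈ 𝓝 (0 : Y), ∃ r : ℝ, 0 < r ∧
      ∀ U ∈ closure (fibre F ℰp J K hJK V ∩ histGood F ℰp (θBal F.L γ b₀ p₀) K J),
        (⨅ w' : {w : Site (F.P K) 0 → Matrix.specialUnitaryGroup (Fin 2) ℂ |
            ∀ U : GaugeField (F.P K) 0 (Matrix.specialUnitaryGroup (Fin 2) ℂ),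
              descendTo F ℰp J K hJK (GaugeField.gaugeAct w U) = descendTo F ℰp J K hJK U},
          ∑ ℓ : PBond (F.P K) 0,
            dist1 (U ℓ * ((GaugeField.gaugeAct (w' : Site (F.P K) 0 → Matrix.specialUnitaryGroup (Fin 2) ℂ) U₀) ℓ)⁻¹) ^ 2) ≤ r →
        ∃ y ∈ s, ∃ w : Site (F.P K) 0 → Matrix.specialUnitaryGroup (Fin 2) ℂ,
          (∀ U'' : GaugeField (F.P K) 0 (Matrix.specialUnitaryGroup (Fin 2) ℂ),
              descendTo F ℰp J K hJK (GaugeField.gaugeAct w U'') = descendTo F ℰp J K hJK U'') ∧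
            U = GaugeField.gaugeAct w (Ψ y)) :
    ∃ r c : ℝ, 0 < r ∧ 0 < c ∧
      ∀ U ∈ closure (fibre F ℰp J K hJK V ∩ histGood F ℰp (θBal F.L γ b₀ p₀) K J),
        (∃ w : Site (F.P K) 0 → Matrix.specialUnitaryGroup (Fin 2) ℂ,
          (∀ U'' : GaugeField (F.P K) 0 (Matrix.specialUnitaryGroup (Fin 2) ℂ),
              descendTo F ℰp J K hJK (GaugeField.gaugeAct w U'') = descendTo F ℰp J K hJK U'') ∧
            ∀ ℓ : PBond (F.P K) 0, dist1 (U ℓ * ((GaugeField.gaugeAct w U₀) ℓ)⁻¹) ≤ δ) →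
        (⨅ w : {w : Site (F.P K) 0 → Matrix.specialUnitaryGroup (Fin 2) ℂ |
            ∀ U : GaugeField (F.P K) 0 (Matrix.specialUnitaryGroup (Fin 2) ℂ),
              descendTo F ℰp J K hJK (GaugeField.gaugeAct w U) = descendTo F ℰp J K hJK U},
          ∑ ℓ : PBond (F.P K) 0,
            dist1 (U ℓ * ((GaugeField.gaugeAct (w : Site (F.P K) 0 → Matrix.specialUnitaryGroup (Fin 2) ℂ) U₀) ℓ)⁻¹) ^ 2) ≤ r →
        c * (⨅ w : {w : Site (F.P K) 0 → Matrix.specialUnitaryGroup (Fin 2) ℂ |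
            ∀ U : GaugeField (F.P K) 0 (Matrix.specialUnitaryGroup (Fin 2) ℂ),
              descendTo F ℰp J K hJK (GaugeField.gaugeAct w U) = descendTo F ℰp J K hJK U},
          ∑ ℓ : PBond (F.P K) 0,
            dist1 (U ℓ * ((GaugeField.gaugeAct (w : Site (F.P K) 0 → Matrix.specialUnitaryGroup (Fin 2) ℂ) U₀) ℓ)⁻¹) ^ 2)
          ≤ wilsonAction4 U - minActionRegPr F J K hJK ε₀ V := by
  obtain ⟨c₁, hc₁, hgrow⟩ := hgrow
  obtain ⟨C, hC, hdict⟩ := hdict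
  obtain ⟨r, hr, hcov⟩ := hcover _ (hgrow.and hdict)
  refine ⟨r, c₁ / C, hr, div_pos hc₁ hC, fun U hU _ hUr => ?_⟩
  obtain ⟨y, ⟨hyg, hyd⟩, w, hw, rfl⟩ := hcov U hU hUr
  rw [iInf_orbitDistSq_gaugeAct_left F hJK hw, wilsonAction4_gaugeAct]
  calc c₁ / C * (⨅ w' : {w : Site (F.P K) 0 → Matrix.specialUnitaryGroup (Fin 2) ℂ |
            ∀ U : GaugeField (F.P K) 0 (Matrix.specialUnitaryGroup (Fin 2) ℂ),
              descendTo F ℰp J K hJK (GaugeField.gaugeAct w U) = descendTo F ℰp J K hJK U},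
          ∑ ℓ : PBond (F.P K) 0,
            dist1 ((Ψ y) ℓ * ((GaugeField.gaugeAct (w' : Site (F.P K) 0 → Matrix.specialUnitaryGroup (Fin 2) ℂ) U₀) ℓ)⁻¹) ^ 2)
        ≤ c₁ / C * (C * ‖y‖ ^ 2) := mul_le_mul_of_nonneg_left hyd (div_pos hc₁ hC).le
    _ = c₁ * ‖y‖ ^ 2 := by field_simp
    _ ≤ wilsonAction4 (Ψ y) - minActionRegPr F J K hJK ε₀ V := hyg

/-- ★★★ **POS∘ COLLAR ⟸ GROWTH ROW + COVER ROW, FOR A TRANSVERSAL WITH DIFFERENTIABLE MATRIX FIELD** (the dictionary row discharged by §3: `Ψ 0 = U₀`,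
`y ↦ ↑(Ψ y)` differentiable at `0` — for the fibred transversal of record `y ↦ c.Φ (V, σ y)` this is ✓`…S2BetaPivotResolveSmooth.contDiffAt_coeField_resolve`).
[cite: Balaban1985Variational, (142) p.299; Balaban1985UV3, (18)-(22) p.260] -/
theorem posCollar_of_growthRow
    (V : GaugeField (F.P J) 0 (Matrix.specialUnitaryGroup (Fin 2) ℂ)) (U₀ : GaugeField (F.P K) 0 (Matrix.specialUnitaryGroup (Fin 2) ℂ)) (δ : ℝ)
    (Ψ : Y → GaugeField (F.P K) 0 (Matrix.specialUnitaryGroup (Fin 2) ℂ)) (hΨ0 : Ψ 0 = U₀)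
    (hΨd : DifferentiableAt ℝ (fun y => coeField (Ψ y)) 0)
    (hgrow : ∃ c₁ : ℝ, 0 < c₁ ∧ ∀ᶠ y in 𝓝 (0 : Y), c₁ * ‖y‖ ^ 2 ≤ wilsonAction4 (Ψ y) - minActionRegPr F J K hJK ε₀ V)
    (hcover : ∀ s ∈ 𝓝 (0 : Y), ∃ r : ℝ, 0 < r ∧
      ∀ U ∈ closure (fibre F ℰp J K hJK V ∩ histGood F ℰp (θBal F.L γ b₀ p₀) K J),
        (⨅ w' : {w : Site (F.P K) 0 → Matrix.specialUnitaryGroup (Fin 2) ℂ |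
            ∀ U : GaugeField (F.P K) 0 (Matrix.specialUnitaryGroup (Fin 2) ℂ),
              descendTo F ℰp J K hJK (GaugeField.gaugeAct w U) = descendTo F ℰp J K hJK U},
          ∑ ℓ : PBond (F.P K) 0,
            dist1 (U ℓ * ((GaugeField.gaugeAct (w' : Site (F.P K) 0 → Matrix.specialUnitaryGroup (Fin 2) ℂ) U₀) ℓ)⁻¹) ^ 2) ≤ r →
        ∃ y ∈ s, ∃ w : Site (F.P K) 0 → Matrix.specialUnitaryGroup (Fin 2) ℂ,
          (∀ U'' : GaugeField (F.P K) 0 (Matrix.specialUnitaryGroup (Fin 2) ℂ),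
              descendTo F ℰp J K hJK (GaugeField.gaugeAct w U'') = descendTo F ℰp J K hJK U'') ∧
            U = GaugeField.gaugeAct w (Ψ y)) :
    ∃ r c : ℝ, 0 < r ∧ 0 < c ∧
      ∀ U ∈ closure (fibre F ℰp J K hJK V ∩ histGood F ℰp (θBal F.L γ b₀ p₀) K J),
        (∃ w : Site (F.P K) 0 → Matrix.specialUnitaryGroup (Fin 2) ℂ,
          (∀ U'' : GaugeField (F.P K) 0 (Matrix.specialUnitaryGroup (Fin 2) ℂ),
              descendTo F ℰp J K hJK (GaugeField.gaugeAct w U'') = descendTo F ℰp J K hJK U'') ∧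
            ∀ ℓ : PBond (F.P K) 0, dist1 (U ℓ * ((GaugeField.gaugeAct w U₀) ℓ)⁻¹) ≤ δ) →
        (⨅ w : {w : Site (F.P K) 0 → Matrix.specialUnitaryGroup (Fin 2) ℂ |
            ∀ U : GaugeField (F.P K) 0 (Matrix.specialUnitaryGroup (Fin 2) ℂ),
              descendTo F ℰp J K hJK (GaugeField.gaugeAct w U) = descendTo F ℰp J K hJK U},
          ∑ ℓ : PBond (F.P K) 0,
            dist1 (U ℓ * ((GaugeField.gaugeAct (w : Site (F.P K) 0 → Matrix.specialUnitaryGroup (Fin 2) ℂ) U₀) ℓ)⁻¹) ^ 2) ≤ r →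
        c * (⨅ w : {w : Site (F.P K) 0 → Matrix.specialUnitaryGroup (Fin 2) ℂ |
            ∀ U : GaugeField (F.P K) 0 (Matrix.specialUnitaryGroup (Fin 2) ℂ),
              descendTo F ℰp J K hJK (GaugeField.gaugeAct w U) = descendTo F ℰp J K hJK U},
          ∑ ℓ : PBond (F.P K) 0,
            dist1 (U ℓ * ((GaugeField.gaugeAct (w : Site (F.P K) 0 → Matrix.specialUnitaryGroup (Fin 2) ℂ) U₀) ℓ)⁻¹) ^ 2)
          ≤ wilsonAction4 U - minActionRegPr F J K hJK ε₀ V :=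
  posCollar_of_growthRow_of_cover F hJK V U₀ δ Ψ hgrow (exists_orbitDist_le_mul_norm_sq F hJK U₀ Ψ hΨ0 hΨd) hcover

end Collar

end Summit.QuantumFields.YangMills.Theorems.FluctuationComparisonRegPrIntLS2BetaPosCollarOfGrowthRow

end
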